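import Summits.KontsevichZagierPeriods.KontsevichZagierPeriods.Theses.AbelContraction
import Summits.KontsevichZagierPeriods.KontsevichZagierPeriods.Theorems.AbelContractionRealHyperellipticSectorDefs
import Summits.KontsevichZagierPeriods.KontsevichZagierPeriods.Theorems.AbelContractionRealHyperellipticSectorBudgetKit
import Summits.KontsevichZagierPeriods.KontsevichZagierPeriods.Theorems.AbelContractionRealHyperellipticSectorStubCells
import Summits.KontsevichZagierPeriods.KontsevichZagierPeriods.Theorems.AbelContractionRealHyperellipticSectorStubEuler
import Summits.KontsevichZagierPeriods.KontsevichZagierPeriods.Theorems.AbelContractionRealHyperellipticSectorStubBakerAlg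
import Summits.KontsevichZagierPeriods.KontsevichZagierPeriods.Theorems.AbelContractionRealHyperellipticSectorStubEngine

/-!
# `RealHyperellipticSector` (crux stmt-KontsevichZagierPeriods-12475) — skeleton `Lines/birth.lean` (lead reshape r3)

Route `AbelContraction`, crux #5 (PROGRAMME): for every `q ∈ ℚ[X]`, every value-`0` element of the
subgroup of `KZ.FormalRep` generated by the one-curve real hyperelliptic sector of `q`
(representations `[σ, (A + B√q)/D]`, `σ ⊂ {q > 0, D ≠ 0}` `ℚ`-semialgebraic, `A B D ∈ ℚ[X]`) and the
`0`-dimensional representations lies in `KZ.relationsLE 1`.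

This file is the BC3 birth certificate of the crux: four NAMED stubs, each a genuine lemma of the
line foreseen in the route header (TWO-LAYER PLAN: "ExactAndConstants → RealCorrespondenceSheets →
RealHyperellipticSector, the first-kind homological part being the engine; its completeness input
(Huber–Wüstholz Thm 13.7) enters as a hypothesis"), and the kernel-checked composition
`RealHyperellipticSector_of` concluding the crux BY NAME.

* `stub_cells` (calculus, dimension `≤ 1`, size M): every element of the sector subgroup is congruent
  modulo `KZ.relationsLE 1` to a combination of ARC generators (same integrands, domain an open
  interval of the line) and constants — o-minimal cell decomposition of a `ℚ`-semialgebraic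
  `σ ⊂ ℝ¹` (`exists_finset_Ioo_subset_or_disjoint`, `isSemialgebraic_singleton_iff`), domain
  additivity (rule 1a) in dimension `1`, and points are null.
* `stub_baker` (genus `0`, the Baker sector inside dimension one, size L): for `deg q ≤ 2` the
  value-`0` arc combinations lie in `KZ.relationsLE 1` (rationalisation of `√q` by one rule-2 move,
  partial fractions = rule 1b, Newton–Leibniz `1 → 0` with algebraic primitives, Baker's theorem —
  in tree — for the `ℚ̄`-relations among `1`, `log α`, `arg w`, realised by scalings / power maps /
  Möbius rotations; kernel form of DimensionBudget's `BakerSectorDimOne`).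
* `stub_engine` (the contraction ENGINE, size XL): the real Cauchy relations
  `Σ_j (−1)^j [O_j, P/√q]` of every M-polynomial `q` (even degree `2g+2`, negative leading
  coefficient, `2g+2` simple real roots, ovals `O_j = (e_{2j}, e_{2j+1})`, `deg P < g`) lie in
  `KZ.relationsLE 1` — the route's `HyperellipticMContraction` (Abel's theorem on the difference
  correspondence, windings `±1` on the real torus `J(ℝ)°`) for real-algebraic, not only rational,
  branch points and arbitrary `P` of degree `< g` (forced by the crux: `q` ranges over `ℚ[X]`).
* `stub_complete` (the COMPLETENESS input, open core: Huber–Wüstholz Thm 13.7 / Ch. 14 transferred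
  to real chains, size open-problem): for `deg q ≥ 3` every value-`0` arc combination lies in the
  subgroup generated by the dimension-`≤ 1` move instances, the real Cauchy relations of ALL sectors
  `q'` (transport between birational models `x ↦ c + 1/u` is a rule-2 move and may change `q`), and
  the genus-`0` kernels — i.e. exact forms (NL `1 → 0`), real correspondences / isogenies (rule 2 sheet
  by sheet) and `ℚ̄`-linearity (rule 1b, scalings) generate everything ONCE the homological part is
  granted.

Composition: `kernel_of_stubs` (sorry-free, axioms propext/Classical.choice/Quot.sound) proves
`stub statements → kernel statement of the crux`: normalise by the cells stub; the normal form has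
value `0` by SOUNDNESS of the calculus (`KZ.relations_le_ker_eval_holds`,
`KZ.relationsLE_le_relations`); for `deg q ≤ 2` conclude by the Baker stub, else completeness puts it
in the closure of `movesLE 1 ∪ ⋃ cauchyRel ∪ bakerKer`, which is `≤ relationsLE 1` by
`KZ.movesLE_subset_relationsLE`, the engine and the Baker stub (`AddSubgroup.closure_le`). The
registered skeleton theorem `RealHyperellipticSector_of : RealHyperellipticSector` (A12 shape: the
crux BY NAME, no hypotheses, the only `sorry` inside `stub_complete`) is
`realHyperellipticSector_iff.mpr
    (kernel_of_stubs stub_cells (baker_of_euler_bakerAlg stub_euler stub_bakerAlg) stub_engine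
      stub_complete)`.

STATUS r3 (2026-08-17, lead c2): the objects of the line live in the tree
(`Theorems/AbelContractionRealHyperellipticSectorDefs.lean`, namespace
`Summit.KontsevichZagierPeriods.AbelContraction.RealHyperellipticSector`, opened below), and FOUR of
the five registered stubs have LANDED and are discharged here by name: `stub_cells`
(…StubCells.lean, p144773), `stub_euler` (…StubEuler.lean + …StubEulerKit/…StubEulerMoves,
p147161), `stub_bakerAlg` (…StubBakerAlg.lean, p154785, on top of the 27-file dimension-certified
port `…Port*.lean` of the tree's dimension-one normal-form development; by-product
`Port.Dlog.kzConjectureLE_of_dim_le_one` = DimensionBudget's `BakerSectorDimOne`) and — NEW in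
r3 — `stub_engine` (…StubEngine.lean, p160618: the contraction engine in ALL genera by the
SEPARATING PENCIL `ψ = q/D²`, one rule-2 move per oval onto `(0,∞)` and the Lagrange cancellation of
the signed push-forwards, bricks …EngineMPolyFactor p158133, …EngineOvalSigns p158407,
…EngineRootGapSign p158419, …EngineSignedSum p158529, …EnginePencilRoots p158606,
…EnginePencilKit p160179; it supersedes the Abel-addition/winding mechanism of the card and makes
the route cruxes `GenusTwoContraction` / `HyperellipticMContraction` corollaries). Also landed for
`stub_complete`: the bricks `arc_exact_sub_const` (…ArcExactSubConst.lean p158881, NL 1→0 with an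
algebraic primitive) and `transport_arcs` (…TransportArcs(Kit).lean p159463/p159785, Möbius
transport between models). OPEN: `stub_complete` only.

Disproof used: none (no `Disproof.lean` is registered on this crux at birth); negatives index
(1 entry, `KinematicPlaneConvex`, convexity of semialgebraic `K`): unrelated — no convexity anywhere.

References: M. Kontsevich, D. Zagier, *Periods* (2001), §1.2 rules (1)–(3) [KontsevichZagier2001];
A. Huber, G. Wüstholz, *Transcendence and linear relations of 1-periods* (2022), Thm 13.7, Ch. 14
[HuberWustholz2022]; B. Gross, J. Harris, *Real algebraic curves* (1981) [GrossHarris1981];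
V. A. Rokhlin (1974) [Rokhlin1974]; A. Baker, *Transcendental Number Theory* (1975) [Baker1975];
L. van den Dries, *Tame topology and o-minimal structures* (1998), Ch. 1 (3.2)–(3.3) [Dries1998].
-/

noncomputable section

set_option linter.dupNamespace false

open Set MeasureTheory
open scoped BigOperators
open Literature.NumberTheory.Transcendental
open Summit.KontsevichZagierPeriods.AbelContraction.RealHyperellipticSector
open Summit.KontsevichZagierPeriods.AbelContraction.RealHyperellipticSector.Budget
  (eval_eq_zero_of_mem_relationsLE)

namespace Summit.KontsevichZagierPeriods.KontsevichZagierPeriods.Cruxes.RealHyperellipticSector.Birth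

/-! ### The objects of the line

`sector q`, `consts`, `arcs q`, `cauchyRel q`, `bakerKer`, `algArcs` and the `Iff.rfl` read-back
`realHyperellipticSector_iff` are the tree declarations of
`Theorems/AbelContractionRealHyperellipticSectorDefs.lean` (opened above). -/

/-! ### Landed stubs (discharged by name) -/

/-- **Stub** `stub_cells` — LANDED (Theorems/AbelContractionRealHyperellipticSectorStubCells.lean,
p144773): every element of the sector subgroup of `q` is congruent modulo `KZ.relationsLE 1` to an
element of the ARC subgroup plus constants (algebraic break points of a `ℚ`-semialgebraic
`σ ⊂ ℝ¹`, rule 1a in dimension `1`, points are null). [cite: Dries1998, Ch. 1 (3.2)-(3.3)]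
[cite: KontsevichZagier2001, §1.2 rule (1)] -/
theorem stub_cells : ∀ (q : Polynomial ℚ), ∀ x ∈ AddSubgroup.closure (sector q ∪ consts),
    ∃ x' ∈ AddSubgroup.closure (arcs q ∪ consts), x - x' ∈ KZ.relationsLE 1 :=
  Summit.KontsevichZagierPeriods.AbelContraction.RealHyperellipticSector.stub_cells

/-- **Stub** `stub_euler` — LANDED (Theorems/AbelContractionRealHyperellipticSectorStubEuler.lean,
p147161): for `deg q ≤ 2` every element of the arc subgroup of `q` plus constants is congruent
modulo `KZ.relationsLE 1` to an element of the subgroup generated by the real-algebraic rational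
arcs `algArcs` and the constants (Euler's substitutions, ONE rule-2 move per arc inside dimension
one). [cite: KontsevichZagier2001, §1.2 rule (2)] -/
theorem stub_euler : ∀ (q : Polynomial ℚ), q.natDegree ≤ 2 →
    ∀ x ∈ AddSubgroup.closure (arcs q ∪ consts),
      ∃ x' ∈ AddSubgroup.closure (algArcs ∪ consts), x - x' ∈ KZ.relationsLE 1 :=
  Summit.KontsevichZagierPeriods.AbelContraction.RealHyperellipticSector.stub_euler

/-- **Stub** `stub_bakerAlg` — LANDED (Theorems/AbelContractionRealHyperellipticSectorStubBakerAlg.lean,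
p154785): every value-`0` element of the subgroup generated by `algArcs` and the constants lies in
`KZ.relationsLE 1` (the tree's dimension-one normal-form development re-certified inside the
budget, 27 `…Port*.lean` files, Baker's theorem `baker_holds`). [cite: Baker1975, Thm 2.1]
[cite: KontsevichZagier2001, §1.2 Conjecture 1] -/
theorem stub_bakerAlg : ∀ x ∈ AddSubgroup.closure (algArcs ∪ consts),
    KZ.eval x = 0 → x ∈ KZ.relationsLE 1 :=
  Summit.KontsevichZagierPeriods.AbelContraction.RealHyperellipticSector.stub_bakerAlg

/-- **Stub** `stub_engine` — LANDED (Theorems/AbelContractionRealHyperellipticSectorStubEngine.lean,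
p160618): every real Cauchy relator `Σ_j (−1)^j [O_j, P/√q]` of every M-polynomial `q ∈ ℚ[X]`
(degree `2g+2`, negative leading coefficient, `2g+2` distinct real roots, `deg P < g`) lies in
`KZ.relationsLE 1` — by the SEPARATING PENCIL: `q = lc·N·D` (even- and odd-indexed branch points),
`ψ = q/D² = −λN/D` maps every oval bijectively onto `(0,∞)` with fibre over `u` the simple roots of
`c_u = λN + uD` (one per oval); one rule-(2) move per oval gives push-forwards
`h_j(u) = (−1)^{g−j} P(x_j)/(√u c_u'(x_j))` on the common domain `(0,∞)`, and
`Σ_j (−1)^j h_j = (−1)^g u^{-1/2} Σ_j P(x_j)/c_u'(x_j) = 0` (Lagrange interpolation, `deg P ≤ deg c_u − 2`)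
makes `Σ_j (−1)^j [(0,∞), h_j]` an iterated rule-(1b) relation. Moves among representations of
dimension `1` only; no Newton–Leibniz, no windings, no factor `2`.
[cite: KontsevichZagier2001, §1.2 rules (1)-(2)] [cite: GrossHarris1981, §3] -/
theorem stub_engine : ∀ (q : Polynomial ℚ), cauchyRel q ⊆ (KZ.relationsLE 1 : Set KZ.FormalRep) :=
  Summit.KontsevichZagierPeriods.AbelContraction.RealHyperellipticSector.stub_engine

/-! ### Registered stubs (open) -/

/-- **Stub** `stub_complete` (COMPLETENESS modulo the engine and the Baker sector — the open core,
Huber–Wüstholz transferred to real chains): for `deg q ≥ 3`, every value-`0` element of the arc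
subgroup of `q` plus constants lies in the subgroup generated by (i) the move instances supported in
dimension `≤ 1` (`KZ.movesLE 1`: rules 1a, 1b, 2 in dimension `1`, Newton–Leibniz `1 → 0`, and the
dimension-`0` instances), (ii) the real Cauchy relators `cauchyRel q'` of ALL M-polynomials `q'`
(an unbounded arc or an odd-degree model is moved to a bounded M-model by the real rule-2 move
`x = c + 1/u`, which changes `q`), and (iii) the genus-`0` kernels `bakerKer`. Why plausibly true:
by Huber–Wüstholz (Thm 13.7 with the case list of Ch. 14) every `ℚ̄`-linear relation among the
1-periods `∫_γ ω` of `y² = q` (all three kinds, `γ` real arcs between real algebraic points) and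
algebraic numbers is generated by exact forms (here NL `1 → 0` with ALGEBRAIC primitives after
Hermite reduction = rule 1b), functoriality along correspondences and isogenies (here rule 2 sheet
by sheet on monotonicity cells — the bet being that REAL correspondences suffice for relations among
REAL arcs, by Galois descent from `ℚ̄` to `ℚ̄ ∩ ℝ`), vanishing of periods of the first kind over
cycles with `l(σ) = 0` (granted here as (ii)), residues (windings `n·[ℝ, 1/(1+w²)]`, inside (iii))
and `ℚ̄`-linearity (rule 1b and `KZ.scale`). Why it might fail: a vanishing forced only through a
NON-real endomorphism (CM) with no real correspondence realising it (probe `y² = x⁵ − x`). Size: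
open-problem (it is where the crux's open content lives once the engine is split off).
[cite: HuberWustholz2022, Thm 13.7, Ch. 14] [cite: KontsevichZagier2001, §1.2]
[cite: Ayoub2015, Rem. 1.5] -/
theorem stub_complete : ∀ (q : Polynomial ℚ), 2 < q.natDegree →
    ∀ x ∈ AddSubgroup.closure (arcs q ∪ consts), KZ.eval x = 0 →
      x ∈ AddSubgroup.closure (KZ.movesLE 1 ∪ (⋃ q' : Polynomial ℚ, cauchyRel q') ∪ bakerKer) := by
  sorry

/-! ### The composition -/

/-- **The Baker sector inside dimension one** (the former registered stub `stub_baker`, now DERIVED,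
sorry-free from the statements of `stub_euler` and `stub_bakerAlg`): for `deg q ≤ 2` every value-`0`
element of the arc subgroup of `q` plus constants lies in `KZ.relationsLE 1` — rationalise by Euler
(the difference is a truncated relation, so the rational normal form keeps value `0` by soundness),
then close by the kernel form for real-algebraic rational arcs. [cite: Baker1975, Thm 2.1]
[cite: KontsevichZagier2001, §1.2 Conjecture 1] -/
theorem baker_of_euler_bakerAlg
    (heuler : ∀ (q : Polynomial ℚ), q.natDegree ≤ 2 →
      ∀ x ∈ AddSubgroup.closure (arcs q ∪ consts),
        ∃ x' ∈ AddSubgroup.closure (algArcs ∪ consts), x - x' ∈ KZ.relationsLE 1)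
    (hbakerAlg : ∀ x ∈ AddSubgroup.closure (algArcs ∪ consts),
      KZ.eval x = 0 → x ∈ KZ.relationsLE 1) :
    ∀ (q : Polynomial ℚ), q.natDegree ≤ 2 →
      ∀ x ∈ AddSubgroup.closure (arcs q ∪ consts), KZ.eval x = 0 → x ∈ KZ.relationsLE 1 := by
  intro q hdeg x hx hx0
  obtain ⟨x', hx', hxx'⟩ := heuler q hdeg x hx
  have hx'0 : KZ.eval x' = 0 := by
    have h := eval_eq_zero_of_mem_relationsLE hxx'
    rwa [map_sub, hx0, zero_sub, neg_eq_zero] at h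
  have hsplit : x = (x - x') + x' := (sub_add_cancel x x').symm
  rw [hsplit]
  exact add_mem hxx' (hbakerAlg x' hx' hx'0)

/-- The generator classes of the line lie in `KZ.relationsLE 1`, granted the engine and the Baker
sector. [cite: KontsevichZagier2001, §1.2] -/
theorem closure_generators_le
    (hbaker : ∀ (q : Polynomial ℚ), q.natDegree ≤ 2 →
      ∀ x ∈ AddSubgroup.closure (arcs q ∪ consts), KZ.eval x = 0 → x ∈ KZ.relationsLE 1)
    (hengine : ∀ (q : Polynomial ℚ), cauchyRel q ⊆ (KZ.relationsLE 1 : Set KZ.FormalRep)) :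
    AddSubgroup.closure (KZ.movesLE 1 ∪ (⋃ q' : Polynomial ℚ, cauchyRel q') ∪ bakerKer) ≤
      KZ.relationsLE 1 := by
  rw [AddSubgroup.closure_le]
  rintro y ((hy | hy) | hy)
  · exact KZ.movesLE_subset_relationsLE 1 hy
  · obtain ⟨q', hq'⟩ := Set.mem_iUnion.mp hy
    exact hengine q' hq'
  · obtain ⟨q', hdeg, hmem, hval⟩ := hy
    exact hbaker q' hdeg y hmem hval

/-- **Composition, hypothetical form** (sorry-free, axioms `propext`/`Classical.choice`/`Quot.sound`):
the four stub STATEMENTS imply the kernel statement of the crux (its `Iff.rfl` read-back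
`realHyperellipticSector_iff`). Normalise to arcs by the cells hypothesis (the difference is a
truncated relation, so the normal form still has value `0` by soundness), then close the genus-`0`
sectors by the Baker hypothesis and the others by completeness, whose generator classes are
truncated relations by the engine and the Baker hypotheses (`closure_generators_le`).
[cite: KontsevichZagier2001, §1.2 Conjecture 1] [cite: HuberWustholz2022, Thm 13.7] -/
theorem kernel_of_stubs
    (hcells : ∀ (q : Polynomial ℚ), ∀ x ∈ AddSubgroup.closure (sector q ∪ consts),
        ∃ x' ∈ AddSubgroup.closure (arcs q ∪ consts), x - x' ∈ KZ.relationsLE 1)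
    (hbaker : ∀ (q : Polynomial ℚ), q.natDegree ≤ 2 →
        ∀ x ∈ AddSubgroup.closure (arcs q ∪ consts), KZ.eval x = 0 → x ∈ KZ.relationsLE 1)
    (hengine : ∀ (q : Polynomial ℚ), cauchyRel q ⊆ (KZ.relationsLE 1 : Set KZ.FormalRep))
    (hcomplete : ∀ (q : Polynomial ℚ), 2 < q.natDegree →
        ∀ x ∈ AddSubgroup.closure (arcs q ∪ consts), KZ.eval x = 0 →
          x ∈ AddSubgroup.closure (KZ.movesLE 1 ∪ (⋃ q' : Polynomial ℚ, cauchyRel q') ∪ bakerKer)) :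
    ∀ (q : Polynomial ℚ), ∀ x ∈ AddSubgroup.closure (sector q ∪ consts),
      KZ.eval x = 0 → x ∈ KZ.relationsLE 1 := by
  intro q x hx hx0
  -- (1) cell normalisation inside dimension ≤ 1
  obtain ⟨x', hx', hxx'⟩ := hcells q x hx
  -- (2) the normal form still has value 0 (soundness of the truncated calculus)
  have hx'0 : KZ.eval x' = 0 := by
    have h := eval_eq_zero_of_mem_relationsLE hxx'
    rwa [map_sub, hx0, zero_sub, neg_eq_zero] at h
  -- (3) genus 0: Baker sector; genus ≥ 1: completeness modulo the engine and the Baker sector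
  have hx'mem : x' ∈ KZ.relationsLE 1 := by
    by_cases hdeg : q.natDegree ≤ 2
    · exact hbaker q hdeg x' hx' hx'0
    · exact closure_generators_le hbaker hengine (hcomplete q (not_le.mp hdeg) x' hx' hx'0)
  -- (4) reassemble
  have hsplit : x = (x - x') + x' := (sub_add_cancel x x').symm
  rw [hsplit]
  exact add_mem hxx' hx'mem

/-- **Composition** (the registered skeleton theorem, A12 shape: concludes the crux BY NAME, no
hypotheses, every `sorry` inside the declared stubs): `RealHyperellipticSector` from `stub_cells`,
`stub_euler`, `stub_bakerAlg`, `stub_engine`, `stub_complete` through the sorry-free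
`baker_of_euler_bakerAlg`, `kernel_of_stubs` and the `Iff.rfl` read-back. [cite: KontsevichZagier2001, §1.2 Conjecture 1] -/
theorem RealHyperellipticSector_of :
    Summit.KontsevichZagierPeriods.KontsevichZagierPeriods.Theses.AbelContraction.RealHyperellipticSector :=
  realHyperellipticSector_iff.mpr
    (kernel_of_stubs stub_cells (baker_of_euler_bakerAlg stub_euler stub_bakerAlg) stub_engine
      stub_complete)

end Summit.KontsevichZagierPeriods.KontsevichZagierPeriods.Cruxes.RealHyperellipticSector.Birth
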